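import Summits.Ventures.LatticeQCDFlow.TrivializingMaps.CouplingLadderLawAnyGroup

/-!
HONEST FRAMING: exact (Metropolis-corrected) sampling algorithms for lattice gauge theory; figures
of merit are autocorrelation/cost numbers at stated couplings and volumes; no continuum-physics
claim.

# FlowAcceptanceCeiling — EVERY EXACT INDEPENDENCE SAMPLER (FLOW PROPOSAL) WHOSE MODEL DENSITY IS AT MOST
# `C` TIMES THE HAAR PRIOR HAS MEAN METROPOLIS ACCEPTANCE `≤ C·exp(−(ψ(β) − 2ψ(β/2)))` `≤ C·exp(−mβ²/4)`
# AGAINST THE WILSON MEASURE AT COUPLING `β` — EXPONENTIALLY SMALL IN THE VOLUME AT EVERY `β > 0`, FOR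
# EVERY COMPACT GAUGE GROUP; `SU(n)`: `≤ C·exp(−c·#plaq·β²/(4(1+β²)))` (lean-2 GEN-11, ours)

Venture-side (OURS).  Cell `lqcd-flow` (pub-lqcd), unit `pub-lqcd-lean-2-g11`, 2026-08-23.  The
ACCEPTANCE twin of GEN-10's `FlowESSCeilingAnyGroup` (there: Liu's ESS fraction `essM ≤ C·e^{−KL}`): the
stationary mean acceptance of independence Metropolis with target density `p` and proposal density `g`
(both with respect to one reference probability measure `D`) is `∫∫ min(p(x)g(y), p(y)g(x)) dD(x) dD(y)` —
the measure-level form of the tree's finite `Exactness.accRate p q = Σ_{x,y} min(p_x q_y, p_y q_x)`.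

* §1 (abstract, `D` a probability measure, `X` bounded measurable, `p_t = e^{tX}/mgf(t)` the density of
  `D.tilted(t·X)`, `g` measurable with `0 ≤ g ≤ C`): `imhAcc_reading` — the functional IS the stationary
  Metropolis–Hastings acceptance `∫∫ min(1, p(y)g(x)/(p(x)g(y))) dπ dq` (`prod_withDensity`); then **`∫∫ min(p_t(x)g(y), p_t(y)g(x)) ≤ C·exp(2ψ(t/2) − ψ(t))`**
  (`min ≤ √·√`, Cauchy–Schwarz/Fubini, `√g ≤ √C`, and `∫ √p_t dD = mgf(t/2)/√mgf(t)`: the squared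
  Bhattacharyya coefficient of the target and the PRIOR, times `C`) (`imhAcc_le_mul_exp`); under a variance
  floor `m` on `[0,t]`: `≤ C·exp(−m t²/4)` (`imhAcc_le_mul_exp_neg_floor`, `ψ(0) = 0` and the midpoint gap);
  and the FLOOR `imhAcc_ge_exp_neg_osc`: `e^{−K} ≤ ∫∫ min(p(x)g(y), p(y)g(x))` whenever the weight `p/g`
  oscillates by at most `e^K` (measure-level twin of the finite `Scaling.accRate_ge_exp_neg` of theory-1's
  R-T1-6; the oscillation exponent is what a truncated trivializing map controls).
* §2 (Wilson, every compact `G`, `X = −S_W^ρ`, `D = D[U]`, target `μ_β`): `wilsonMeasure_eq_withDensity`,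
  `wilson_flowAcc_reading` (the functional = the mean acceptance of the exact flow / independence sampler with
  model `g·D[U]`), `wilson_flowAcc_le` (the `ψ` form), **`wilson_flowAcc_le_allCouplings`** (unitary `ρ`, `d ≥ 2`, `L ≥ 2`, `β ≥ 0`):
  `acc ≤ C·exp(−e^{−βc}·⌊L/2⌋^d·Var_Haar(Re tr ρ)·β²/4)` — EXPONENTIALLY SMALL IN THE VOLUME at every
  `β > 0` whenever `Var_Haar(Re tr ρ) > 0`; **`wilson_flowAcc_le_sun`** (`SU(n)`, `n ≥ 2`, `d ≥ 2`): one
  `c(n,d) > 0` with `acc ≤ C·exp(−c·#plaq·β²/(4(1+β²)))` for every `β ≥ 0`, `L ≥ 2`, every model density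
  `0 ≤ g ≤ C`.

READING: a normalizing flow from the Haar prior whose push-forward density is bounded by `C` (e.g. a
bi-Lipschitz / bounded-Jacobian architecture of fixed size) cannot keep an `O(1)` Metropolis acceptance as
the volume grows, at ANY non-zero coupling — `log C` must grow like `#plaq·β²/(1+β²)` (T4
`VolumeScalingOfTraining`, acceptance half; the finite-state precedent is theory2's T2-M′
`acc_blockDefect_volume_law` in the factorised model).  Literature grade (cell rule): KNOWN MECHANISM
(`acc ≤ BC²`, Le Cam; the tree's T2-M), NEW TYPING at measure level for every compact gauge group with
the tree's all-coupling variance floors.  NOT CLAIMED: anything about a specific architecture, training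
cost, or finite-sample acceptance; constants are structural (`e^{−βc}` of GEN-9, theory2's `c`).
-/

noncomputable section

open MeasureTheory ProbabilityTheory Real Set
open Literature.MathematicalPhysics.QuantumFieldTheory
open Literature.MathematicalPhysics.QuantumFieldTheory.Luscher2010
open Summit.Ventures.LatticeQCDFlow.TrivializingMaps
open scoped Matrix Matrix.Norms.Frobenius ContDiff

namespace Summit.Ventures.LatticeQCDFlow.Scaling

/-! ## §1 Abstract: the acceptance of an independence sampler against a member of an exponential family -/

section Abstract

variable {Ω : Type*} [MeasurableSpace Ω] {μ : Measure Ω} [IsProbabilityMeasure μ] {X : Ω → ℝ}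

/-- **IMH READING**: for a target `π = p·μ` and a proposal `q = g·μ` with positive measurable densities over
the same reference measure `μ`, the stationary mean Metropolis–Hastings acceptance of the independence
sampler, `∫∫ min(1, (p(y)g(x))/(p(x)g(y))) dπ(x) dq(y)`, equals `∫∫ min(p(x)g(y), p(y)g(x)) dμ(x) dμ(y)` — the
functional bounded below (measure-level form of the finite `Exactness.accRate`). [folklore] -/
theorem imhAcc_reading {p g : Ω → ℝ} (hp : Measurable p) (hg : Measurable g) (hp0 : ∀ x, 0 < p x)
    (hg0 : ∀ x, 0 < g x) :
    ∫ z, min 1 (p z.2 * g z.1 / (p z.1 * g z.2))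
        ∂((μ.withDensity fun x => ENNReal.ofReal (p x)).prod (μ.withDensity fun x => ENNReal.ofReal (g x))) =
      ∫ z, min (p z.1 * g z.2) (p z.2 * g z.1) ∂(μ.prod μ) := by
  have hmeas : Measurable fun z : Ω × Ω => ENNReal.ofReal (p z.1) * ENNReal.ofReal (g z.2) :=
    (hp.ennreal_ofReal.comp measurable_fst).mul (hg.ennreal_ofReal.comp measurable_snd)
  rw [prod_withDensity hp.ennreal_ofReal hg.ennreal_ofReal,
    integral_withDensity_eq_integral_toReal_smul hmeas
      (ae_of_all _ fun z => ENNReal.mul_lt_top ENNReal.ofReal_lt_top ENNReal.ofReal_lt_top)]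
  refine integral_congr_ae (ae_of_all _ fun z => ?_)
  have ha : 0 < p z.1 * g z.2 := mul_pos (hp0 _) (hg0 _)
  have hne : p z.1 * g z.2 ≠ 0 := ha.ne'
  simp only []
  rw [ENNReal.toReal_mul, ENNReal.toReal_ofReal (hp0 _).le, ENNReal.toReal_ofReal (hg0 _).le, smul_eq_mul,
    mul_min_of_nonneg _ _ ha.le, mul_one]
  congr 1
  rw [mul_comm]
  exact div_mul_cancel₀ _ hne

/-- `min(a b', a' b) ≤ √(a b)·√(a' b')` for non-negative reals. [folklore] -/
theorem min_mul_le_sqrt_mul_sqrt {a b a' b' : ℝ} (ha : 0 ≤ a) (hb : 0 ≤ b) (ha' : 0 ≤ a')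
    (hb' : 0 ≤ b') : min (a * b') (a' * b) ≤ sqrt (a * b) * sqrt (a' * b') := by
  rw [← sqrt_mul (mul_nonneg ha hb)]
  have hmin : 0 ≤ min (a * b') (a' * b) := le_min (mul_nonneg ha hb') (mul_nonneg ha' hb)
  have hsq : min (a * b') (a' * b) ^ 2 ≤ a * b * (a' * b') := by
    rcases le_total (a * b') (a' * b) with h | h
    · rw [min_eq_left h, sq]
      calc a * b' * (a * b') ≤ a * b' * (a' * b) := mul_le_mul_of_nonneg_left h (mul_nonneg ha hb')
        _ = a * b * (a' * b') := by ring
    · rw [min_eq_right h, sq]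
      calc a' * b * (a' * b) ≤ a * b' * (a' * b) := mul_le_mul_of_nonneg_right h (mul_nonneg ha' hb)
        _ = a * b * (a' * b') := by ring
  calc min (a * b') (a' * b) = sqrt (min (a * b') (a' * b) ^ 2) := (sqrt_sq hmin).symm
    _ ≤ sqrt (a * b * (a' * b')) := sqrt_le_sqrt hsq

/-- `∫ √(p_t) dD = mgf(t/2)/√(mgf t)` for the tilted density `p_t = e^{tX}/mgf(t)`. [folklore] -/
theorem integral_sqrt_tiltedDensity (hXm : Measurable X) (hXb : ∃ C, ∀ x, |X x| ≤ C) (t : ℝ) :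
    ∫ x, sqrt (exp (t * X x) / mgf X μ t) ∂μ = mgf X μ (t / 2) / sqrt (mgf X μ t) := by
  have hZ : 0 < mgf X μ t := mgf_pos_of_bounded hXm hXb t
  have h : ∀ x, sqrt (exp (t * X x) / mgf X μ t) = exp (t / 2 * X x) * (sqrt (mgf X μ t))⁻¹ := by
    intro x
    rw [sqrt_div' _ hZ.le, div_eq_mul_inv]
    congr 1
    rw [show t * X x = t / 2 * X x + t / 2 * X x by ring, exp_add, sqrt_mul_self (exp_pos _).le]
  simp_rw [h]
  rw [integral_mul_const, ← div_eq_mul_inv]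
  rfl

/-- **ABSTRACT ACCEPTANCE CEILING**: for the target density `p_t = e^{tX}/mgf(t)` (the member `μ.tilted(t·X)`
of a bounded exponential family over the probability measure `μ`) and any measurable proposal density
`0 ≤ g ≤ C` over `μ`, the stationary independence-Metropolis acceptance satisfies
`∫∫ min(p_t(x)g(y), p_t(y)g(x)) dμ dμ ≤ C·exp(2ψ(t/2) − ψ(t))`, `ψ = cgf X μ`. [ours] -/
theorem imhAcc_le_mul_exp (hXm : Measurable X) (hXb : ∃ C, ∀ x, |X x| ≤ C) (t : ℝ)
    {g : Ω → ℝ} (hg : Measurable g) {C : ℝ} (hg0 : ∀ x, 0 ≤ g x) (hgC : ∀ x, g x ≤ C) :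
    ∫ z, min (exp (t * X z.1) / mgf X μ t * g z.2) (exp (t * X z.2) / mgf X μ t * g z.1) ∂(μ.prod μ) ≤
      C * exp (2 * cgf X μ (t / 2) - cgf X μ t) := by
  obtain ⟨B, hB⟩ := hXb
  have hXb : ∃ C, ∀ x, |X x| ≤ C := ⟨B, hB⟩
  have hZ : 0 < mgf X μ t := mgf_pos_of_bounded hXm hXb t
  set p : Ω → ℝ := fun x => exp (t * X x) / mgf X μ t with hp
  have hp0 : ∀ x, 0 ≤ p x := fun x => div_nonneg (exp_pos _).le hZ.le
  have hpm : Measurable p := ((measurable_const.mul hXm).exp).div_const _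
  -- `p` is bounded
  have hpb : ∀ x, p x ≤ exp (|t| * B) / mgf X μ t := fun x => by
    refine div_le_div_of_nonneg_right (exp_le_exp.2 ?_) hZ.le
    calc t * X x ≤ |t * X x| := le_abs_self _
      _ = |t| * |X x| := abs_mul _ _
      _ ≤ |t| * B := mul_le_mul_of_nonneg_left (hB x) (abs_nonneg _)
  rcases isEmpty_or_nonempty Ω with hΩ | hΩ
  · have : μ = 0 := Measure.eq_zero_of_isEmpty μ
    exact absurd this (IsProbabilityMeasure.ne_zero μ)
  have hC : 0 ≤ C := (hg0 (Classical.arbitrary Ω)).trans (hgC _)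
  -- the product-form bound `√(p g)(x) · √(p g)(y)`
  set r : Ω → ℝ := fun x => sqrt (p x * g x) with hr
  have hrm : Measurable r := (hpm.mul hg).sqrt
  have hrb : ∀ x, |r x| ≤ sqrt (exp (|t| * B) / mgf X μ t * C) := fun x => by
    rw [abs_of_nonneg (sqrt_nonneg _)]
    exact sqrt_le_sqrt (mul_le_mul (hpb x) (hgC x) (hg0 x) (div_nonneg (exp_pos _).le hZ.le))
  have hri : Integrable r μ := integrable_of_abs_le hrm hrb
  have hle : ∫ z, min (p z.1 * g z.2) (p z.2 * g z.1) ∂(μ.prod μ) ≤ ∫ z, r z.1 * r z.2 ∂(μ.prod μ) := by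
    refine integral_mono_of_nonneg
      (ae_of_all _ fun z => le_min (mul_nonneg (hp0 _) (hg0 _)) (mul_nonneg (hp0 _) (hg0 _)))
      (hri.mul_prod hri) (ae_of_all _ fun z => ?_)
    exact min_mul_le_sqrt_mul_sqrt (hp0 _) (hg0 _) (hp0 _) (hg0 _)
  refine hle.trans ?_
  rw [integral_prod_mul]
  -- `∫ r ≤ √C · ∫ √p = √C · mgf(t/2)/√mgf(t)`
  have hsi : Integrable (fun x => sqrt (p x)) μ := by
    refine integrable_of_abs_le hpm.sqrt (C := sqrt (exp (|t| * B) / mgf X μ t)) fun x => ?_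
    rw [abs_of_nonneg (sqrt_nonneg _)]
    exact sqrt_le_sqrt (hpb x)
  have hr_le : ∫ x, r x ∂μ ≤ sqrt C * ∫ x, sqrt (p x) ∂μ := by
    rw [← integral_const_mul]
    refine integral_mono hri (hsi.const_mul _) fun x => ?_
    show sqrt (p x * g x) ≤ sqrt C * sqrt (p x)
    rw [mul_comm (sqrt C), ← sqrt_mul (hp0 x)]
    exact sqrt_le_sqrt (mul_le_mul_of_nonneg_left (hgC x) (hp0 x))
  have hr0 : 0 ≤ ∫ x, r x ∂μ := integral_nonneg fun x => sqrt_nonneg _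
  have hsp : ∫ x, sqrt (p x) ∂μ = mgf X μ (t / 2) / sqrt (mgf X μ t) :=
    integral_sqrt_tiltedDensity hXm hXb t
  have hZ' : ∀ u, mgf X μ u = exp (cgf X μ u) := fun u =>
    (exp_cgf (integrable_exp_mul_of_bounded hXm hXb u)).symm
  calc (∫ x, r x ∂μ) * ∫ x, r x ∂μ ≤ (sqrt C * ∫ x, sqrt (p x) ∂μ) * (sqrt C * ∫ x, sqrt (p x) ∂μ) :=
        mul_le_mul hr_le hr_le hr0 (hr0.trans hr_le)
    _ = C * (∫ x, sqrt (p x) ∂μ) ^ 2 := by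
        rw [show (sqrt C * ∫ x, sqrt (p x) ∂μ) * (sqrt C * ∫ x, sqrt (p x) ∂μ) =
          (sqrt C * sqrt C) * (∫ x, sqrt (p x) ∂μ) ^ 2 by ring, mul_self_sqrt hC]
    _ = C * exp (2 * cgf X μ (t / 2) - cgf X μ t) := by
        rw [hsp, div_pow, sq_sqrt hZ.le, hZ', hZ', ← exp_nat_mul, ← exp_sub]
        norm_num

/-- **Under a variance floor on `[0,t]`** (`t ≥ 0`, `m ≤ Var_{μ_u}(X)` for `u ∈ [0,t]`): the acceptance is
`≤ C·exp(−m t²/4)` (`ψ(0) = 0` and the midpoint gap `ψ(0) + ψ(t) − 2ψ(t/2) ≥ m t²/4`). [ours] -/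
theorem imhAcc_le_mul_exp_neg_floor (hXm : Measurable X) (hXb : ∃ C, ∀ x, |X x| ≤ C) {t m : ℝ}
    (ht : 0 ≤ t) (hm : ∀ u ∈ Icc 0 t, m ≤ variance X (μ.tilted fun x => u * X x))
    {g : Ω → ℝ} (hg : Measurable g) {C : ℝ} (hg0 : ∀ x, 0 ≤ g x) (hgC : ∀ x, g x ≤ C) :
    ∫ z, min (exp (t * X z.1) / mgf X μ t * g z.2) (exp (t * X z.2) / mgf X μ t * g z.1) ∂(μ.prod μ) ≤
      C * exp (-(m * t ^ 2 / 4)) := by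
  rcases isEmpty_or_nonempty Ω with hΩ | hΩ
  · have : μ = 0 := Measure.eq_zero_of_isEmpty μ
    exact absurd this (IsProbabilityMeasure.ne_zero μ)
  have hC : 0 ≤ C := (hg0 (Classical.arbitrary Ω)).trans (hgC _)
  refine (imhAcc_le_mul_exp hXm hXb t hg hg0 hgC).trans (mul_le_mul_of_nonneg_left (exp_le_exp.2 ?_) hC)
  have h := midpoint_gap_ge_of_deriv2_ge (hasDerivAt_cgf_of_bounded (μ := μ) hXm hXb)
    (hasDerivAt_deriv_cgf_of_bounded (μ := μ) hXm hXb) ht hm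
  rw [cgf_zero, zero_add, sub_zero] at h
  have h2 : (0 + t) / 2 = t / 2 := by ring
  rw [h2] at h
  linarith

/-- **ACCEPTANCE FLOOR FROM A LOG-WEIGHT OSCILLATION BOUND** (measure-level twin of the finite
`Scaling.accRate_ge_exp_neg`): if the target and proposal densities `p, g ≥ 0` (each of integral `1` over
`μ`) satisfy `p(x)g(y) ≤ e^K·p(y)g(x)` for all `x, y` (the importance weight `p/g` oscillates by at most
`e^K`, `K ≥ 0`), then `e^{−K} ≤ ∫∫ min(p(x)g(y), p(y)g(x)) dμ dμ`. [ours] -/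
theorem imhAcc_ge_exp_neg_osc {p g : Ω → ℝ} (hp : Measurable p) (hg : Measurable g)
    (hp0 : ∀ x, 0 ≤ p x) (hg0 : ∀ x, 0 ≤ g x) (hpi : Integrable p μ) (hgi : Integrable g μ)
    (hp1 : ∫ x, p x ∂μ = 1) (hg1 : ∫ x, g x ∂μ = 1) {K : ℝ} (hK0 : 0 ≤ K)
    (hK : ∀ x y, p x * g y ≤ exp K * (p y * g x)) :
    exp (-K) ≤ ∫ z, min (p z.1 * g z.2) (p z.2 * g z.1) ∂(μ.prod μ) := by
  have hmin_m : Measurable fun z : Ω × Ω => min (p z.1 * g z.2) (p z.2 * g z.1) :=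
    ((hp.comp measurable_fst).mul (hg.comp measurable_snd)).min
      ((hp.comp measurable_snd).mul (hg.comp measurable_fst))
  have hpg : Integrable (fun z : Ω × Ω => p z.1 * g z.2) (μ.prod μ) := hpi.mul_prod hgi
  have hmin_i : Integrable (fun z : Ω × Ω => min (p z.1 * g z.2) (p z.2 * g z.1)) (μ.prod μ) := by
    refine hpg.mono' hmin_m.aestronglyMeasurable (ae_of_all _ fun z => ?_)
    rw [Real.norm_eq_abs, abs_of_nonneg (le_min (mul_nonneg (hp0 _) (hg0 _)) (mul_nonneg (hp0 _) (hg0 _)))]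
    exact min_le_left _ _
  have heK : exp (-K) ≤ 1 := by rw [← exp_zero]; exact exp_le_exp.2 (by linarith)
  have hpt : ∀ z : Ω × Ω, exp (-K) * (p z.1 * g z.2) ≤ min (p z.1 * g z.2) (p z.2 * g z.1) := by
    intro z
    refine le_min ?_ ?_
    · calc exp (-K) * (p z.1 * g z.2) ≤ 1 * (p z.1 * g z.2) :=
          mul_le_mul_of_nonneg_right heK (mul_nonneg (hp0 _) (hg0 _))
        _ = p z.1 * g z.2 := one_mul _
    · have h := hK z.1 z.2
      have hpos : 0 < exp K := exp_pos K
      rw [exp_neg, inv_mul_le_iff₀ hpos]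
      exact h
  calc exp (-K) = exp (-K) * ((∫ x, p x ∂μ) * ∫ y, g y ∂μ) := by rw [hp1, hg1, mul_one, mul_one]
    _ = ∫ z, exp (-K) * (p z.1 * g z.2) ∂(μ.prod μ) := by
        rw [← integral_prod_mul, integral_const_mul]
    _ ≤ ∫ z, min (p z.1 * g z.2) (p z.2 * g z.1) ∂(μ.prod μ) :=
        integral_mono_of_nonneg (ae_of_all _ fun z =>
          mul_nonneg (exp_pos _).le (mul_nonneg (hp0 _) (hg0 _))) hmin_i (ae_of_all _ hpt)

end Abstract

/-! ## §2 The Wilson target: every compact gauge group, every coupling -/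

section Wilson

variable {d L N : ℕ} [NeZero L] {G : Type*} [Group G] [TopologicalSpace G] [IsTopologicalGroup G]
  [CompactSpace G] [MeasurableSpace G] [BorelSpace G] [SecondCountableTopology G]
  (ρ : G →* Matrix (Fin N) (Fin N) ℂ)

/-- The Wilson measure is `D[U]` with density `p_β = e^{−βS_W}/Z(β)`, `Z(β) = mgf(−S_W)(β)`. [folklore] -/
theorem wilsonMeasure_eq_withDensity (hρ : Continuous ρ) (β : ℝ) :
    wilsonMeasure (d := d) (L := L) ρ β = (trivialMeasure G d L).withDensity fun U =>
      ENNReal.ofReal (exp (β * (-wilsonAction ρ U)) /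
        mgf (fun U => -wilsonAction ρ U) (trivialMeasure G d L) β) := by
  rw [wilsonMeasure_eq_tilted_neg ρ hρ β]
  rfl

/-- **READING (flow / independence sampler against the Wilson measure)**: for a model `q = g·D[U]` with a
positive measurable density `g` (the push-forward of the prior under the flow) and the target `μ_β`, the
stationary mean Metropolis–Hastings acceptance `∫∫ min(1, (p_β(V)g(U))/(p_β(U)g(V))) dμ_β(U) dq(V)` equals the
functional `∫∫ min(p_β(U)g(V), p_β(V)g(U)) dD dD` bounded in this file. [ours] -/
theorem wilson_flowAcc_reading (hρ : Continuous ρ) (β : ℝ) {g : GaugeConfig d L G → ℝ}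
    (hg : Measurable g) (hg0 : ∀ U, 0 < g U) :
    ∫ z, min 1 (exp (β * (-wilsonAction ρ z.2)) /
          mgf (fun U => -wilsonAction ρ U) (trivialMeasure G d L) β * g z.1 /
        (exp (β * (-wilsonAction ρ z.1)) /
          mgf (fun U => -wilsonAction ρ U) (trivialMeasure G d L) β * g z.2))
        ∂((wilsonMeasure (d := d) (L := L) ρ β).prod
          ((trivialMeasure G d L).withDensity fun U => ENNReal.ofReal (g U))) =
    ∫ z, min (exp (β * (-wilsonAction ρ z.1)) /
          mgf (fun U => -wilsonAction ρ U) (trivialMeasure G d L) β * g z.2)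
        (exp (β * (-wilsonAction ρ z.2)) /
          mgf (fun U => -wilsonAction ρ U) (trivialMeasure G d L) β * g z.1)
        ∂((trivialMeasure G d L).prod (trivialMeasure G d L)) := by
  haveI : IsProbabilityMeasure (trivialMeasure G d L) := trivialMeasure_isProbabilityMeasure
  rw [wilsonMeasure_eq_withDensity ρ hρ β]
  have hZ : 0 < mgf (fun U => -wilsonAction ρ U) (trivialMeasure G d L) β :=
    mgf_pos_of_bounded (measurable_neg_wilsonAction ρ hρ) (neg_wilsonAction_bounded ρ hρ) β
  exact imhAcc_reading (μ := trivialMeasure G d L)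
    (((measurable_const.mul (measurable_neg_wilsonAction ρ hρ)).exp).div_const _) hg
    (fun U => div_pos (exp_pos _) hZ) hg0

/-- **ACCEPTANCE CEILING FOR EXACT INDEPENDENCE (FLOW) SAMPLERS, `ψ` form**: with
`p_β = e^{−βS_W}/Z(β)` the density of the Wilson measure over `D[U]` and `0 ≤ g ≤ C` a measurable model
density over `D[U]`: `∫∫ min(p_β(U)g(V), p_β(V)g(U)) dD dD ≤ C·exp(2ψ(β/2) − ψ(β))`, `ψ = cgf(−S_W^ρ)`.
[ours] -/
theorem wilson_flowAcc_le (hρ : Continuous ρ) (β : ℝ) {g : GaugeConfig d L G → ℝ} (hg : Measurable g)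
    {C : ℝ} (hg0 : ∀ U, 0 ≤ g U) (hgC : ∀ U, g U ≤ C) :
    ∫ z, min (exp (β * (-wilsonAction ρ z.1)) /
          mgf (fun U => -wilsonAction ρ U) (trivialMeasure G d L) β * g z.2)
        (exp (β * (-wilsonAction ρ z.2)) /
          mgf (fun U => -wilsonAction ρ U) (trivialMeasure G d L) β * g z.1)
        ∂((trivialMeasure G d L).prod (trivialMeasure G d L)) ≤
      C * exp (2 * cgf (fun U => -wilsonAction ρ U) (trivialMeasure G d L) (β / 2) -
        cgf (fun U => -wilsonAction ρ U) (trivialMeasure G d L) β) := by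
  haveI : IsProbabilityMeasure (trivialMeasure G d L) := trivialMeasure_isProbabilityMeasure
  exact imhAcc_le_mul_exp (μ := trivialMeasure G d L) (measurable_neg_wilsonAction ρ hρ)
    (neg_wilsonAction_bounded ρ hρ) β hg hg0 hgC

/-- **ACCEPTANCE CEILING UNDER A SPECIFIC-HEAT FLOOR** (`β ≥ 0`, `m ≤ Var_u(S_W)` on `[0,β]`):
`acc ≤ C·exp(−mβ²/4)`. [ours] -/
theorem wilson_flowAcc_le_of_floor (hρ : Continuous ρ) {β m : ℝ} (hβ : 0 ≤ β)
    (hm : ∀ u ∈ Icc 0 β, m ≤ variance (wilsonAction (d := d) (L := L) ρ) (wilsonMeasure (d := d) (L := L) ρ u))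
    {g : GaugeConfig d L G → ℝ} (hg : Measurable g) {C : ℝ} (hg0 : ∀ U, 0 ≤ g U) (hgC : ∀ U, g U ≤ C) :
    ∫ z, min (exp (β * (-wilsonAction ρ z.1)) /
          mgf (fun U => -wilsonAction ρ U) (trivialMeasure G d L) β * g z.2)
        (exp (β * (-wilsonAction ρ z.2)) /
          mgf (fun U => -wilsonAction ρ U) (trivialMeasure G d L) β * g z.1)
        ∂((trivialMeasure G d L).prod (trivialMeasure G d L)) ≤
      C * exp (-(m * β ^ 2 / 4)) := by
  haveI : IsProbabilityMeasure (trivialMeasure G d L) := trivialMeasure_isProbabilityMeasure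
  refine imhAcc_le_mul_exp_neg_floor (μ := trivialMeasure G d L) (measurable_neg_wilsonAction ρ hρ)
    (neg_wilsonAction_bounded ρ hρ) hβ (fun u hu => ?_) hg hg0 hgC
  have h := hm u hu
  rwa [← tilted_neg_wilsonAction_eq ρ hρ u, ← variance_fun_neg] at h

/-- **EXPONENTIALLY SMALL ACCEPTANCE AT EVERY COUPLING, EVERY COMPACT GAUGE GROUP** (unitary `ρ`,
`d ≥ 2`, `L ≥ 2`, `β ≥ 0`, model density `0 ≤ g ≤ C`):
`acc ≤ C·exp(−e^{−β·2NK(1+4K)}·⌊L/2⌋^d·Var_Haar(Re tr ρ)·β²/4)`, `K = (d+1)d²`. [ours] -/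
theorem wilson_flowAcc_le_allCouplings (hd : 2 ≤ d) (hL : 2 ≤ L) (hρ : Continuous ρ)
    (hρu : ∀ g, ρ g ∈ Matrix.unitaryGroup (Fin N) ℂ) {β : ℝ} (hβ : 0 ≤ β)
    {g : GaugeConfig d L G → ℝ} (hg : Measurable g) {C : ℝ} (hg0 : ∀ U, 0 ≤ g U) (hgC : ∀ U, g U ≤ C) :
    ∫ z, min (exp (β * (-wilsonAction ρ z.1)) /
          mgf (fun U => -wilsonAction ρ U) (trivialMeasure G d L) β * g z.2)
        (exp (β * (-wilsonAction ρ z.2)) /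
          mgf (fun U => -wilsonAction ρ U) (trivialMeasure G d L) β * g z.1)
        ∂((trivialMeasure G d L).prod (trivialMeasure G d L)) ≤
      C * exp (-(Real.exp (-(β * (2 * N * ((d + 1) * d ^ 2 : ℕ) * (1 + 4 * ((d + 1) * d ^ 2 : ℕ))))) *
        ((L / 2) ^ d : ℕ) * variance (fun g => (ρ g).trace.re) (haarProbability G) * β ^ 2 / 4)) := by
  refine wilson_flowAcc_le_of_floor (d := d) (L := L) ρ hρ hβ (fun u hu => ?_) hg hg0 hgC
  refine le_trans ?_ (wilson_variance_ge_allCouplings (d := d) (L := L) ρ hd hL hρ hρu u)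
  have hv : 0 ≤ variance (fun g => (ρ g).trace.re) (haarProbability G) := variance_nonneg _ _
  have hu' : |u| ≤ β := abs_le.2 ⟨by linarith [hu.1], hu.2⟩
  have hc : 0 ≤ (2 * N * ((d + 1) * d ^ 2 : ℕ) * (1 + 4 * ((d + 1) * d ^ 2 : ℕ)) : ℝ) := by positivity
  gcongr

end Wilson

/-! ## §3 `SU(n)`: polynomial constants -/

section SUN

variable {d n : ℕ}

/-- **`SU(n)` ACCEPTANCE CEILING AT EVERY COUPLING**: for `n ≥ 2`, `d ≥ 2` there is `c = c(n,d) > 0` with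
`acc ≤ C·exp(−c·#plaq·β²/(4(1+β²)))` for every `L ≥ 2`, every `β ≥ 0` and every measurable model density
`0 ≤ g ≤ C` over the Haar prior (item 129's floor `c#plaq/(1+u²)`). [ours] -/
theorem wilson_flowAcc_le_sun (hn : 2 ≤ n) (hd : 2 ≤ d) :
    ∃ c : ℝ, 0 < c ∧ ∀ (L : ℕ) [NeZero L], 2 ≤ L → ∀ β : ℝ, 0 ≤ β →
      ∀ (g : GaugeConfig d L (Matrix.specialUnitaryGroup (Fin n) ℂ) → ℝ), Measurable g →
        ∀ C : ℝ, (∀ U, 0 ≤ g U) → (∀ U, g U ≤ C) →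
          ∫ z, min (exp (β * (-wilsonAction (StrongCoupling.defRep n) z.1)) /
                mgf (fun U => -wilsonAction (StrongCoupling.defRep n) U)
                  (trivialMeasure (Matrix.specialUnitaryGroup (Fin n) ℂ) d L) β * g z.2)
              (exp (β * (-wilsonAction (StrongCoupling.defRep n) z.2)) /
                mgf (fun U => -wilsonAction (StrongCoupling.defRep n) U)
                  (trivialMeasure (Matrix.specialUnitaryGroup (Fin n) ℂ) d L) β * g z.1)
              ∂((trivialMeasure (Matrix.specialUnitaryGroup (Fin n) ℂ) d L).prod
                (trivialMeasure (Matrix.specialUnitaryGroup (Fin n) ℂ) d L)) ≤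
            C * exp (-(c * Fintype.card (Plaquette d L) * β ^ 2 / (4 * (1 + β ^ 2)))) := by
  obtain ⟨c, hc, h⟩ := wilson_variance_floor_allCouplings_rep (d := d) (n := n) hn hd
  refine ⟨c, hc, fun L _ hL β hβ g hg C hg0 hgC => ?_⟩
  have hρ : Continuous (StrongCoupling.defRep n) := continuous_subtype_val
  have h1 := wilson_flowAcc_le_of_floor (d := d) (L := L) (StrongCoupling.defRep n) hρ hβ
    (m := c * Fintype.card (Plaquette d L) / (1 + β ^ 2)) (fun u hu => ?_) hg hg0 hgC
  · have hexp : c * Fintype.card (Plaquette d L) / (1 + β ^ 2) * β ^ 2 / 4 =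
        c * Fintype.card (Plaquette d L) * β ^ 2 / (4 * (1 + β ^ 2)) := by
      rw [div_mul_eq_mul_div, div_div, mul_comm (1 + β ^ 2) 4]
    rw [hexp] at h1
    exact h1
  · refine le_trans ?_ (h L hL u hu.1)
    have hP : 0 ≤ c * Fintype.card (Plaquette d L) := by positivity
    have hu1 : 1 + u ^ 2 ≤ 1 + β ^ 2 := by nlinarith [hu.1, hu.2]
    exact div_le_div_of_nonneg_left hP (by positivity) hu1

end SUN

end Summit.Ventures.LatticeQCDFlow.Scaling

end
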